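import Literature.MathematicalPhysics.KineticTheory.CollisionTubeWeightOscillation
import Literature.MathematicalPhysics.KineticTheory.CollisionFluxUpperBound
import Literature.MathematicalPhysics.KineticTheory.HardSphereCanonicalPairBound
import Summits.AtomisticToContinuum.HydrodynamicLimit.Theorems.JParityClosureCollisionTightnessSweptTube
import Summits.AtomisticToContinuum.HydrodynamicLimit.Theorems.JParityClosureCollisionTightnessTorusGibbs
import Summits.AtomisticToContinuum.HydrodynamicLimit.Theorems.JParityClosureOddContactSymmetryGibbsInvariance
import Summits.AtomisticToContinuum.HydrodynamicLimit.Theorems.JParityClosureEvenStressEnskogKineticEnergyTight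
import Summits.AtomisticToContinuum.HydrodynamicLimit.Theorems.JParityClosureDensityCapMeanDisplacement
import HarnessLib

/-!
# Crux `JParityClosure.EvenStressEnskog` (stmt-AtomisticToContinuum-13079), line
# `even-rung-mean-variance`: the continuity correction at rung 0 from the short-flight deficit
# (`continuityCorrectionRung0_of_shortFlight`, registered helper of `stub_continuityCorrectionRung0`)

At RUNG 0 (constant profiles; the local Gibbs law is the homogeneous canonical Gibbs law `G_N`,
stationary under every hard-sphere flow) the statement (S2b₁)₀ "`G_N{((N+1)κ)⁻¹ R_cont > η} ≤ δ` for
`κ < κ₀` and `N ≥ N₀`" on the CONTINUITY CORRECTION `R_cont = continuityCorrection` of the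
collision-cylinder pull-back follows from the statement (S2b₂)₀ on the SHORT-FLIGHT DEFICIT
`R_short = shortFlightDeficit` (the registered neighbouring stub `stub_shortFlightDeficitRung0`, taken
here verbatim as the antecedent):

* pathwise, on a good orbit with kinetic energy `≤ E₀(N+1)`,
  `((N+1)κ)⁻¹ R_cont ≤ ε/(N+1) · Σ_coll b_N(vᵢ, vⱼ) + 2C_χC_g · ((N+1)κ)⁻¹ R_short`
  (`continuityCorrection_le` of `Literature/…/CollisionTubeWeightOscillation`, the mean displacement
  along the orbit being `Theorems.stub_meanDisplacement`), with the explicit velocity mark `b_N` built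
  from the moduli of continuity of `χ` and `g` at the displacement scale `κ ε_N (1 + ‖vᵢ‖ + ‖vⱼ‖)`;
* the energy event is small uniformly in `N` (`stub_kineticEnergyTight`);
* `G_N{ε/(N+1) Σ_coll b_N ≥ η/2} ≤ 32 τ σ³ η⁻¹ ∫ ‖w − v‖ b_N dN(u,θ)^{⊗2}` by the collision-flux upper
  bound `localGibbsLaw_collisionMarkSum_ge_le` (Markov + stationarity + one-window statics, the
  Ruelle-type pair bound `posGibbs_pairEvent_le`), and the Gaussian integral tends to the small constant
  `C_Ψ(C_gϵ₁ + C_χϵ₂) ∫‖w − v‖` as `N → ∞` by dominated convergence (`ε_N → 0`, `tendsto_hsDiameter`);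
* the short-flight event at level `η/(2(2C_χC_g + 1))` is the antecedent fed with `g ≡ 0` (which
  `R_short` ignores), whose thresholds `σ₀, κ₀, N₀` are folded into ours.

References: C. Cercignani, R. Illner, M. Pulvirenti, *The Mathematical Theory of Dilute Gases* (1994),
§2.2 and App. 4.A; I. Gallagher, L. Saint-Raymond, B. Texier, *From Newton to Boltzmann* (2013), §4.1.
-/

noncomputable section

open MeasureTheory Set Filter Topology
open scoped ENNReal InnerProductSpace BigOperators

namespace Summit.AtomisticToContinuum.HydrodynamicLimit.Theorems.EvenStressEnskog

open Literature.Analysis.FluidPDE Literature.MathematicalPhysics.KineticTheory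

/-! ### The reduction in probability -/

/-- **The continuity correction at rung 0 from the short-flight deficit** ((S2b₂)₀ ⇒ (S2b₁)₀ for the
line `even-rung-mean-variance` of crux stmt-AtomisticToContinuum-13079).  Assuming the short-flight
statement (the antecedent, verbatim the registered stub `stub_shortFlightDeficitRung0`), for constant
profiles and `N ≥ N₀(…, κ)` the event `{((N+1)κ)⁻¹ R_cont > η}` has Gibbs probability `≤ δ`:
pathwise `((N+1)κ)⁻¹ R_cont ≤ ε/(N+1) Σ_coll b_N(vᵢ, vⱼ) + 2C_χC_g ((N+1)κ)⁻¹ R_short` on the good set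
with energy `≤ E₀(N+1)` (`continuityCorrection_le`); the energy event is small by
`stub_kineticEnergyTight`, the velocity-mark collision sum by the collision-flux upper bound
`localGibbsLaw_collisionMarkSum_ge_le` and dominated convergence in `N` (`ε_N → 0`, the mark tends to
`C_Ψ(C_gϵ₁ + C_χϵ₂)` with `ϵ₁, ϵ₂` chosen from the moduli of continuity of `χ` and `g`), and the
short-flight event by the antecedent (fed with `g ≡ 0`, which `R_short` ignores). [folklore] -/
theorem continuityCorrectionRung0_of_shortFlight : (∃ η₀ : ℝ, 0 < η₀ ∧ ∀ (a θ : ℝ) (u : V3), 0 < a → 0 < θ → ∃ σ₀ : ℝ, 0 < σ₀ ∧ ∀ σ : ℝ, 0 < σ → σ < σ₀ → ∀ Φ : (N : ℕ) → HardSphereFlow (Torus.geometry (Fin 3)) (hsDiameter σ N) (N + 1), ∀ τ : ℝ, 0 < τ → ∀ χ : ℝ × UnitAddTorus (Fin 3) → ℝ, Continuous χ → ∀ g : ℝ → ℝ, Continuous g → (∀ a, η₀ ≤ a → g a = 0) → ∀ η δ : ℝ, 0 < η → 0 < δ → ∃ r₀ : ℝ, 0 < r₀ ∧ ∀ r : ℝ,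 0 < r → r < r₀ → ∀ L : ℝ, 1 ≤ L → ∃ κ₀ : ℝ, 0 < κ₀ ∧ ∀ κ : ℝ, 0 < κ → κ < κ₀ → ∃ N₀ : ℕ, ∀ N : ℕ, N₀ ≤ N → ∀ k l : Fin 3, localGibbsLaw σ (fun _ => a) (fun _ => u) (fun _ => θ) N (Φ N) {z | η < ((N + 1 : ℝ) * κ)⁻¹ * shortFlightDeficit σ N (Φ N) τ (evenMarkTrunc k l L) κ z} ≤ ENNReal.ofReal δ) → ∃ η₀ : ℝ, 0 < η₀ ∧ ∀ (a θ : ℝ) (u : V3), 0 < a → 0 < θ → ∃ σ₀ : ℝ, 0 < σ₀ ∧ ∀ σ : ℝ, 0 < σ → σ < σ₀ → ∀ Φ : (N : ℕ) → HardSphereFlow (Torus.geometry (Fin 3)) (hsDiameter σ N) (N + 1), ∀ τ : ℝ, 0 < τ → ∀ χ : ℝ × UnitAddTorus (Fin 3) → ℝ, Continuous χ → ∀ g : ℝ → ℝ, Continuous g → (∀ a, η₀ ≤ a → g a = 0) → ∀ η δ : ℝ, 0 < η → 0 < δ → ∃ r₀ : ℝ, 0 < r₀ ∧ ∀ r : ℝ,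 0 < r → r < r₀ → ∀ L : ℝ, 1 ≤ L → ∃ κ₀ : ℝ, 0 < κ₀ ∧ ∀ κ : ℝ, 0 < κ → κ < κ₀ → ∃ N₀ : ℕ, ∀ N : ℕ, N₀ ≤ N → ∀ k l : Fin 3, localGibbsLaw σ (fun _ => a) (fun _ => u) (fun _ => θ) N (Φ N) {z | η < ((N + 1 : ℝ) * κ)⁻¹ * continuityCorrection σ N (Φ N) τ χ g (evenMarkTrunc k l L) r κ z} ≤ ENNReal.ofReal δ := by
  intro hSF
  obtain ⟨η₀S, _, hSF0⟩ := hSF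
  refine ⟨1, one_pos, fun a θ u ha hθ => ?_⟩
  obtain ⟨σ₁, hσ₁, hsmall⟩ := exists_smallDensity uniformProfile one_pos
  obtain ⟨σ₂, hσ₂, hKE⟩ := stub_kineticEnergyTight (fun _ => a) (fun _ => θ) (fun _ => u)
    continuous_const continuous_const continuous_const (fun _ => ha) (fun _ => hθ)
  obtain ⟨σ₃, hσ₃, hSF₁⟩ := hSF0 a θ u ha hθ
  refine ⟨min σ₁ (min σ₂ σ₃), lt_min hσ₁ (lt_min hσ₂ hσ₃), fun σ hσ hσlt Φ τ hτ χ hχ g hg hg1 η δ hη hδ => ?_⟩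
  have hσ1 : σ < σ₁ := hσlt.trans_le (min_le_left _ _)
  have hσ2 : σ < σ₂ := hσlt.trans_le ((min_le_right _ _).trans (min_le_left _ _))
  have hσ3 : σ < σ₃ := hσlt.trans_le ((min_le_right _ _).trans (min_le_right _ _))
  have hsm : SmallDensity uniformProfile σ := (hsmall σ hσ hσ1).1
  obtain ⟨Cχ, hCχ0, hχb⟩ := exists_abs_bound_chi hχ τ
  obtain ⟨Cg, hCg0, hgb⟩ := exists_abs_bound_of_cutoff hg hg1
  set C₂ : ℝ := 2 * Cχ * Cg + 1 with hC₂
  have hC₂0 : 0 < C₂ := by rw [hC₂]; positivity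
  obtain ⟨rS, hrS, hSF₂⟩ := hSF₁ σ hσ hσ3 Φ τ hτ χ hχ (fun _ => 0) continuous_const (fun _ _ => rfl)
    (η / (2 * C₂)) (δ / 3) (by positivity) (by positivity)
  refine ⟨1, one_pos, fun r hr _ L hL => ?_⟩
  obtain ⟨κS, hκS, hSF₃⟩ := hSF₂ (rS / 2) (by positivity) (by linarith) L hL
  refine ⟨κS, hκS, fun κ hκ hκlt => ?_⟩
  obtain ⟨NS, hNS⟩ := hSF₃ κ hκ hκlt
  obtain ⟨E₀, NK, hK⟩ := hKE σ hσ hσ2 Φ (δ / 3) (by positivity)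
  -- constants
  have hL0 : 0 < L := by linarith
  set CΨ : ℝ := 2 * L with hCΨ
  have hCΨ0 : 0 < CΨ := by rw [hCΨ]; linarith
  set γ := gaussMeasure u θ with hγ
  set M₁ : ℝ≥0∞ := ∫⁻ p, ENNReal.ofReal ‖p.2 - p.1‖ ∂(γ.prod γ) with hM₁
  have hM₁ne : M₁ ≠ ∞ := lintegral_norm_sub_gauss_ne_top u θ
  set cI : ℝ := δ * η / (128 * τ * σ ^ 3) with hcI
  have hcI0 : 0 < cI := by rw [hcI]; positivity
  set bmax : ℝ := cI / (2 * (M₁.toReal + 1)) with hbmax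
  have hbmax0 : 0 < bmax := by rw [hbmax]; positivity
  set ϵ₁ : ℝ := bmax / (2 * CΨ * (Cg + 1)) with hϵ₁
  set ϵ₂ : ℝ := bmax / (2 * CΨ * (Cχ + 1)) with hϵ₂
  have hϵ₁0 : 0 < ϵ₁ := by rw [hϵ₁]; positivity
  have hϵ₂0 : 0 < ϵ₂ := by rw [hϵ₂]; positivity
  -- moduli of continuity of `χ` on `[0, τ] × 𝕋³` and of `g` on `[0, 3σ³/(πr³)]`
  obtain ⟨Δ₁, hΔ₁, hχuc⟩ : ∃ Δ₁ > 0, ∀ p ∈ Icc (0 : ℝ) τ ×ˢ (univ : Set T3), ∀ q ∈ Icc (0 : ℝ) τ ×ˢ (univ : Set T3),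
      dist p q ≤ Δ₁ → dist (χ p) (χ q) ≤ ϵ₁ :=
    Metric.uniformContinuousOn_iff_le.1
      (((isCompact_Icc (a := (0 : ℝ)) (b := τ)).prod (isCompact_univ (X := T3))).uniformContinuousOn_of_continuous
        hχ.continuousOn) ϵ₁ hϵ₁0
  obtain ⟨Δ₂, hΔ₂, hguc⟩ : ∃ Δ₂ > 0, ∀ x ∈ Icc (0 : ℝ) (σ ^ 3 * (3 / (Real.pi * r ^ 3))),
      ∀ y ∈ Icc (0 : ℝ) (σ ^ 3 * (3 / (Real.pi * r ^ 3))), dist x y ≤ Δ₂ → dist (g x) (g y) ≤ ϵ₂ :=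
    Metric.uniformContinuousOn_iff_le.1
      ((isCompact_Icc (a := (0 : ℝ)) (b := σ ^ 3 * (3 / (Real.pi * r ^ 3)))).uniformContinuousOn_of_continuous
        hg.continuousOn) ϵ₂ hϵ₂0
  -- the velocity marks `b_n`
  set bfun : ℕ → V3 × V3 → ℝ := fun n p => CΨ *
    (Cg * (if κ * hsDiameter σ n * (1 + (‖p.1‖ + ‖p.2‖)) ≤ Δ₁ then ϵ₁ else 2 * Cχ) +
      Cχ * (if σ ^ 3 * (3 / (Real.pi * r ^ 4)) * (κ * hsDiameter σ n * (Real.sqrt (2 * E₀) + (‖p.1‖ + ‖p.2‖))) ≤ Δ₂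
        then ϵ₂ else 2 * Cg)) with hbfun
  have hbm : ∀ n, Measurable (bfun n) := by
    intro n
    refine measurable_const.mul ((measurable_const.mul ?_).add (measurable_const.mul ?_))
    · exact Measurable.ite (measurableSet_le (by fun_prop) measurable_const) measurable_const measurable_const
    · exact Measurable.ite (measurableSet_le (by fun_prop) measurable_const) measurable_const measurable_const
  have hb0 : ∀ n p, 0 ≤ bfun n p := by
    intro n p
    refine mul_nonneg hCΨ0.le (add_nonneg (mul_nonneg hCg0 ?_) (mul_nonneg hCχ0 ?_)) <;>
      split_ifs <;> positivity
  set Bmax : ℝ := CΨ * (Cg * max ϵ₁ (2 * Cχ) + Cχ * max ϵ₂ (2 * Cg)) with hBmax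
  have hBmax0 : 0 ≤ Bmax := by rw [hBmax]; positivity
  have hbB : ∀ n p, bfun n p ≤ Bmax := by
    intro n p
    refine mul_le_mul_of_nonneg_left (add_le_add (mul_le_mul_of_nonneg_left ?_ hCg0)
      (mul_le_mul_of_nonneg_left ?_ hCχ0)) hCΨ0.le
    · split_ifs
      · exact le_max_left _ _
      · exact le_max_right _ _
    · split_ifs
      · exact le_max_left _ _
      · exact le_max_right _ _
  set blim : ℝ := CΨ * (Cg * ϵ₁ + Cχ * ϵ₂) with hblim
  have hblim0 : 0 ≤ blim := by rw [hblim]; positivity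
  have hblimle : blim ≤ bmax := by
    have h1 : CΨ * (Cg * ϵ₁) ≤ bmax / 2 := by
      rw [hϵ₁, show CΨ * (Cg * (bmax / (2 * CΨ * (Cg + 1)))) = bmax / 2 * (Cg / (Cg + 1)) by field_simp]
      exact mul_le_of_le_one_right (by positivity) ((div_le_one (by positivity)).2 (by linarith))
    have h2 : CΨ * (Cχ * ϵ₂) ≤ bmax / 2 := by
      rw [hϵ₂, show CΨ * (Cχ * (bmax / (2 * CΨ * (Cχ + 1)))) = bmax / 2 * (Cχ / (Cχ + 1)) by field_simp]
      exact mul_le_of_le_one_right (by positivity) ((div_le_one (by positivity)).2 (by linarith))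
    rw [hblim, mul_add]
    linarith
  -- dominated convergence in the particle number: `∫ ‖w − v‖ b_n → blim · M₁ < cI`
  have hmn : Measurable fun p : V3 × V3 => ‖p.2 - p.1‖ := by fun_prop
  have hlim : Tendsto (fun n => ∫⁻ p, ENNReal.ofReal (‖p.2 - p.1‖ * bfun n p) ∂(γ.prod γ)) atTop
      (𝓝 (∫⁻ p, ENNReal.ofReal (‖p.2 - p.1‖ * blim) ∂(γ.prod γ))) := by
    refine tendsto_lintegral_of_dominated_convergence (fun p => ENNReal.ofReal (‖p.2 - p.1‖ * Bmax))
      (fun n => (hmn.mul (hbm n)).ennreal_ofReal)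
      (fun n => Eventually.of_forall fun p => ENNReal.ofReal_le_ofReal
        (mul_le_mul_of_nonneg_left (hbB n p) (norm_nonneg _))) ?_ (Eventually.of_forall fun p => ?_)
    · have h : ∫⁻ p, ENNReal.ofReal (‖p.2 - p.1‖ * Bmax) ∂(γ.prod γ) = ENNReal.ofReal Bmax * M₁ := by
        rw [hM₁, ← lintegral_const_mul' _ _ ENNReal.ofReal_ne_top]
        refine lintegral_congr fun p => ?_
        rw [mul_comm, ENNReal.ofReal_mul hBmax0]
      rw [h]
      exact ENNReal.mul_ne_top ENNReal.ofReal_ne_top hM₁ne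
    · have hε := tendsto_hsDiameter σ
      have e1 : ∀ᶠ n in atTop, κ * hsDiameter σ n * (1 + (‖p.1‖ + ‖p.2‖)) ≤ Δ₁ := by
        have ht : Tendsto (fun n => κ * hsDiameter σ n * (1 + (‖p.1‖ + ‖p.2‖))) atTop (𝓝 0) := by
          simpa using ((hε.const_mul κ).mul_const (1 + (‖p.1‖ + ‖p.2‖)))
        exact (ht.eventually_lt_const hΔ₁).mono fun n hn => hn.le
      have e2 : ∀ᶠ n in atTop, σ ^ 3 * (3 / (Real.pi * r ^ 4)) *
          (κ * hsDiameter σ n * (Real.sqrt (2 * E₀) + (‖p.1‖ + ‖p.2‖))) ≤ Δ₂ := by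
        have ht : Tendsto (fun n => σ ^ 3 * (3 / (Real.pi * r ^ 4)) *
            (κ * hsDiameter σ n * (Real.sqrt (2 * E₀) + (‖p.1‖ + ‖p.2‖)))) atTop (𝓝 0) := by
          simpa using (((hε.const_mul κ).mul_const (Real.sqrt (2 * E₀) + (‖p.1‖ + ‖p.2‖))).const_mul
            (σ ^ 3 * (3 / (Real.pi * r ^ 4))))
        exact (ht.eventually_lt_const hΔ₂).mono fun n hn => hn.le
      refine tendsto_const_nhds.congr' ?_
      filter_upwards [e1, e2] with n h1 h2
      simp only [hbfun, hblim, if_pos h1, if_pos h2]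
  have hlimval : ∫⁻ p, ENNReal.ofReal (‖p.2 - p.1‖ * blim) ∂(γ.prod γ) < ENNReal.ofReal cI := by
    have h : ∫⁻ p, ENNReal.ofReal (‖p.2 - p.1‖ * blim) ∂(γ.prod γ) = ENNReal.ofReal blim * M₁ := by
      rw [hM₁, ← lintegral_const_mul' _ _ ENNReal.ofReal_ne_top]
      refine lintegral_congr fun p => ?_
      rw [mul_comm, ENNReal.ofReal_mul hblim0]
    rw [h, ← ENNReal.ofReal_toReal hM₁ne, ← ENNReal.ofReal_mul hblim0]
    refine (ENNReal.ofReal_lt_ofReal_iff hcI0).2 ?_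
    have hM0 : 0 ≤ M₁.toReal := ENNReal.toReal_nonneg
    calc blim * M₁.toReal ≤ bmax * M₁.toReal := mul_le_mul_of_nonneg_right hblimle hM0
      _ = cI / 2 * (M₁.toReal / (M₁.toReal + 1)) := by rw [hbmax]; field_simp
      _ ≤ cI / 2 * 1 := by
          gcongr
          exact (div_le_one (by positivity)).2 (by linarith)
      _ < cI := by linarith
  obtain ⟨N₁, hN₁⟩ := eventually_atTop.1 (hlim.eventually_lt_const hlimval)
  -- the threshold in `N`
  refine ⟨max (max N₁ NK) (max NS 1), fun N hN k l => ?_⟩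
  have hNN₁ : N₁ ≤ N := (le_max_left _ _).trans ((le_max_left _ _).trans hN)
  have hNNK : NK ≤ N := (le_max_right _ _).trans ((le_max_left _ _).trans hN)
  have hNNS : NS ≤ N := (le_max_left _ _).trans ((le_max_right _ _).trans hN)
  have hN1 : 1 ≤ N := (le_max_right _ _).trans ((le_max_right _ _).trans hN)
  have hε0 : 0 < hsDiameter σ N := hsDiameter_pos hσ N
  have hΨb : ∀ q, |evenMarkTrunc k l L q| ≤ CΨ := fun q => by rw [hCΨ]; exact abs_evenMarkTrunc_le k l hL0.le q
  set Mu : ℝ := hsDiameter σ N / (N + 1 : ℝ) with hMu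
  have hMu0 : 0 < Mu := by rw [hMu]; positivity
  set y : ℝ := η / (2 * Mu) with hy
  have hy0 : 0 < y := by rw [hy]; positivity
  -- the three bounds
  have hBK := localGibbsLaw_collisionMarkSum_ge_le hsm.σ_lt_half.le ha hθ u (Φ N)
    (measurePreserving_flow_localGibbsLaw_const σ a θ u N (Φ N))
    (fun i j hij T hT => posGibbs_pairEvent_le hsm hN1 hij hT)
    (fun h hh => exists_sweptTube (hsDiameter_pos hσ N) hh)
    (fun S hS => by simpa only [sub_zero] using volume_setOf_exists_reprSym_add_latticeVec_mem_le 0 hS)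
    hτ (hbm N) (hb0 N) hy0
  have hI : ∫⁻ p, ENNReal.ofReal (‖p.2 - p.1‖ * bfun N p) ∂(γ.prod γ) < ENNReal.ofReal cI := hN₁ N hNN₁
  have hKEN := hK N hNNK 0
  have hSN := hNS N hNNS k l
  have hgood0 : localGibbsLaw σ (fun _ => a) (fun _ => u) (fun _ => θ) N (Φ N) (Φ N).goodᶜ = 0 := by
    rw [localGibbsLaw_eq]
    exact localGibbsMeasure_absolutelyContinuous σ _ _ _ N (Φ N) (Φ N).measure_compl_good
  -- the inclusion of events
  have hsub : {z | η < ((N + 1 : ℝ) * κ)⁻¹ * continuityCorrection σ N (Φ N) τ χ g (evenMarkTrunc k l L) r κ z} ⊆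
      (Φ N).goodᶜ ∪ {z | E₀ < ((N : ℝ) + 1)⁻¹ * configEnergy ((Φ N).flow 0 z)} ∪
        {z | z ∈ (Φ N).good ∧ y ≤ ∑ᶠ s ∈ collisionTimes (Torus.geometry (Fin 3)) (hsDiameter σ N)
            (fun t => (Φ N).flow t z) ∩ Icc 0 τ,
          ∑ i : Fin (N + 1), ∑ j : Fin (N + 1),
            (if i ≠ j ∧ ‖(Torus.geometry (Fin 3)).sepVec ((Φ N).flow s z i).1 ((Φ N).flow s z j).1‖ =
                hsDiameter σ N then bfun N (((Φ N).flow s z i).2, ((Φ N).flow s z j).2) else 0)} ∪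
        {z | η / (2 * C₂) < ((N + 1 : ℝ) * κ)⁻¹ * shortFlightDeficit σ N (Φ N) τ (evenMarkTrunc k l L) κ z} := by
    intro z hz
    rw [mem_setOf_eq] at hz
    by_cases hgood : z ∈ (Φ N).good
    swap
    · exact Or.inl (Or.inl (Or.inl hgood))
    by_cases hEz : E₀ < ((N : ℝ) + 1)⁻¹ * configEnergy ((Φ N).flow 0 z)
    · exact Or.inl (Or.inl (Or.inr hEz))
    have hE' : ((N + 1 : ℕ) : ℝ)⁻¹ * configEnergy z ≤ E₀ := by
      rw [(Φ N).flow_zero z hgood] at hEz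
      push_cast
      exact not_lt.1 hEz
    have hCC := continuityCorrection_le hgood hσ hr hκ hϵ₁0.le hϵ₂0.le hχb hgb hΨb hχuc hguc hE'
      (fun s t => Theorems.stub_meanDisplacement (Φ N) hgood s t) (bfun N) (fun s i j => le_of_eq rfl)
    rw [collisionPairSum_eq_finsum_ite (orbit_mem hgood)] at hCC
    -- name the collision sum of the mark and the deficit term
    obtain ⟨K, hKdef, hCC'⟩ : ∃ K : ℝ, K = (∑ᶠ s ∈ collisionTimes (Torus.geometry (Fin 3)) (hsDiameter σ N)
            (fun t => (Φ N).flow t z) ∩ Icc 0 τ,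
          ∑ i : Fin (N + 1), ∑ j : Fin (N + 1),
            (if i ≠ j ∧ ‖(Torus.geometry (Fin 3)).sepVec ((Φ N).flow s z i).1 ((Φ N).flow s z j).1‖ =
                hsDiameter σ N then bfun N (((Φ N).flow s z i).2, ((Φ N).flow s z j).2) else 0)) ∧
        continuityCorrection σ N (Φ N) τ χ g (evenMarkTrunc k l L) r κ z ≤
          κ * hsDiameter σ N * K + 2 * Cχ * Cg * shortFlightDeficit σ N (Φ N) τ (evenMarkTrunc k l L) κ z :=
      ⟨_, rfl, hCC⟩
    have hSFD0 : 0 ≤ shortFlightDeficit σ N (Φ N) τ (evenMarkTrunc k l L) κ z :=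
      collisionPairSum_nonneg fun t i j => mul_nonneg (abs_nonneg _) (le_max_right _ _)
    obtain ⟨T, hTdef, hT0⟩ : ∃ T : ℝ, T = ((N + 1 : ℝ) * κ)⁻¹ * shortFlightDeficit σ N (Φ N) τ (evenMarkTrunc k l L) κ z ∧
        0 ≤ T := ⟨_, rfl, mul_nonneg (by positivity) hSFD0⟩
    have hκne : κ ≠ 0 := hκ.ne'
    have hN0 : (N + 1 : ℝ) ≠ 0 := by positivity
    have hX : ((N + 1 : ℝ) * κ)⁻¹ * continuityCorrection σ N (Φ N) τ χ g (evenMarkTrunc k l L) r κ z ≤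
        Mu * K + 2 * Cχ * Cg * T := by
      calc ((N + 1 : ℝ) * κ)⁻¹ * continuityCorrection σ N (Φ N) τ χ g (evenMarkTrunc k l L) r κ z
          ≤ ((N + 1 : ℝ) * κ)⁻¹ * (κ * hsDiameter σ N * K +
              2 * Cχ * Cg * shortFlightDeficit σ N (Φ N) τ (evenMarkTrunc k l L) κ z) :=
            mul_le_mul_of_nonneg_left hCC' (by positivity)
        _ = Mu * K + 2 * Cχ * Cg * T := by
            rw [hMu, hTdef]
            field_simp
    by_cases hcase : η / 2 ≤ Mu * K
    · refine Or.inl (Or.inr ⟨hgood, ?_⟩)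
      rw [hy, ← hKdef]
      exact (div_le_iff₀ (by positivity)).2 (by linarith)
    · refine Or.inr ?_
      rw [mem_setOf_eq, ← hTdef]
      have h1 : η / 2 < 2 * Cχ * Cg * T := by linarith [not_le.1 hcase]
      have h2 : 2 * Cχ * Cg * T ≤ C₂ * T := mul_le_mul_of_nonneg_right (by rw [hC₂]; linarith) hT0
      exact (div_lt_iff₀ (by positivity)).2 (by linarith)
  -- the velocity-mark event
  have hBK' : localGibbsLaw σ (fun _ => a) (fun _ => u) (fun _ => θ) N (Φ N) {z | z ∈ (Φ N).good ∧ y ≤ ∑ᶠ s ∈ collisionTimes (Torus.geometry (Fin 3)) (hsDiameter σ N)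
            (fun t => (Φ N).flow t z) ∩ Icc 0 τ,
          ∑ i : Fin (N + 1), ∑ j : Fin (N + 1),
            (if i ≠ j ∧ ‖(Torus.geometry (Fin 3)).sepVec ((Φ N).flow s z i).1 ((Φ N).flow s z j).1‖ =
                hsDiameter σ N then bfun N (((Φ N).flow s z i).2, ((Φ N).flow s z j).2) else 0)} ≤
      ENNReal.ofReal (δ / 4) := by
    refine hBK.trans ?_
    calc (ENNReal.ofReal y)⁻¹ * (ENNReal.ofReal (16 * τ * ((N + 1 : ℕ) : ℝ) ^ 2 * hsDiameter σ N ^ 2) *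
          ∫⁻ p, ENNReal.ofReal (‖p.2 - p.1‖ * bfun N p) ∂(γ.prod γ))
        ≤ (ENNReal.ofReal y)⁻¹ * (ENNReal.ofReal (16 * τ * ((N + 1 : ℕ) : ℝ) ^ 2 * hsDiameter σ N ^ 2) *
            ENNReal.ofReal cI) := by
          gcongr
      _ = ENNReal.ofReal (y⁻¹ * (16 * τ * ((N + 1 : ℕ) : ℝ) ^ 2 * hsDiameter σ N ^ 2) * cI) := by
          rw [← ENNReal.ofReal_inv_of_pos hy0, ← ENNReal.ofReal_mul (by positivity),
            ← ENNReal.ofReal_mul (by positivity)]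
          congr 1
          ring
      _ = ENNReal.ofReal (δ / 4) := by
          congr 1
          have hε3 : ((N + 1 : ℕ) : ℝ) * hsDiameter σ N ^ 3 = σ ^ 3 := succ_mul_hsDiameter_pow_three σ N
          rw [hy, hMu, hcI, ← hε3]
          push_cast
          field_simp
          ring
  -- assembly
  have step1 := measure_mono (μ := localGibbsLaw σ (fun _ => a) (fun _ => u) (fun _ => θ) N (Φ N)) hsub
  have step2 : localGibbsLaw σ (fun _ => a) (fun _ => u) (fun _ => θ) N (Φ N) ((Φ N).goodᶜ ∪
        {z | E₀ < ((N : ℝ) + 1)⁻¹ * configEnergy ((Φ N).flow 0 z)} ∪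
        {z | z ∈ (Φ N).good ∧ y ≤ ∑ᶠ s ∈ collisionTimes (Torus.geometry (Fin 3)) (hsDiameter σ N)
            (fun t => (Φ N).flow t z) ∩ Icc 0 τ,
          ∑ i : Fin (N + 1), ∑ j : Fin (N + 1),
            (if i ≠ j ∧ ‖(Torus.geometry (Fin 3)).sepVec ((Φ N).flow s z i).1 ((Φ N).flow s z j).1‖ =
                hsDiameter σ N then bfun N (((Φ N).flow s z i).2, ((Φ N).flow s z j).2) else 0)} ∪
        {z | η / (2 * C₂) < ((N + 1 : ℝ) * κ)⁻¹ * shortFlightDeficit σ N (Φ N) τ (evenMarkTrunc k l L) κ z}) ≤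
      localGibbsLaw σ (fun _ => a) (fun _ => u) (fun _ => θ) N (Φ N) (Φ N).goodᶜ +
        localGibbsLaw σ (fun _ => a) (fun _ => u) (fun _ => θ) N (Φ N)
          {z | E₀ < ((N : ℝ) + 1)⁻¹ * configEnergy ((Φ N).flow 0 z)} +
        localGibbsLaw σ (fun _ => a) (fun _ => u) (fun _ => θ) N (Φ N) {z | z ∈ (Φ N).good ∧ y ≤
          ∑ᶠ s ∈ collisionTimes (Torus.geometry (Fin 3)) (hsDiameter σ N)
            (fun t => (Φ N).flow t z) ∩ Icc 0 τ,
          ∑ i : Fin (N + 1), ∑ j : Fin (N + 1),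
            (if i ≠ j ∧ ‖(Torus.geometry (Fin 3)).sepVec ((Φ N).flow s z i).1 ((Φ N).flow s z j).1‖ =
                hsDiameter σ N then bfun N (((Φ N).flow s z i).2, ((Φ N).flow s z j).2) else 0)} +
        localGibbsLaw σ (fun _ => a) (fun _ => u) (fun _ => θ) N (Φ N)
          {z | η / (2 * C₂) < ((N + 1 : ℝ) * κ)⁻¹ * shortFlightDeficit σ N (Φ N) τ (evenMarkTrunc k l L) κ z} :=
    (measure_union_le _ _).trans (add_le_add ((measure_union_le _ _).trans
      (add_le_add (measure_union_le _ _) le_rfl)) le_rfl)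
  have step3 := add_le_add (add_le_add (add_le_add hgood0.le hKEN) hBK') hSN
  have step4 : (0 : ℝ≥0∞) + ENNReal.ofReal (δ / 3) + ENNReal.ofReal (δ / 4) + ENNReal.ofReal (δ / 3) ≤ ENNReal.ofReal δ := by
    rw [zero_add, ← ENNReal.ofReal_add (by positivity) (by positivity),
      ← ENNReal.ofReal_add (by positivity) (by positivity)]
    exact ENNReal.ofReal_le_ofReal (by linarith)
  exact step1.trans (step2.trans (step3.trans step4))

end Summit.AtomisticToContinuum.HydrodynamicLimit.Theorems.EvenStressEnskog

end
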